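import Mathlib

/-!
# EriceRemainderEnclosureHistoryAutonomyComparisonAgeCompositionStaticChainSaturationMajorant — (E77b) THE SATURATION GAME MAJORISES THE LEVEL-COUPLED ROW:
# processing the older ages of a young scale NEAREST FIRST, any family `ĝ` obeying the game's recursion
# `ĝ_j ≤ max(1, (X_z φ_j + Σ_{i nearer} X_i ĝ_i S_{ij}) ∕ c_j)` is dominated by the true level ratios `g_j = a_j∕a_z` as soon as every older row holds in
# slack form with a relaxed slack `c_j ≥ ε_j` (`g_j c_j ≥ X_z φ_j + Σ_{i nearer} X_i g_i S_{ij}`) and the levels are monotone (`g_j ≥ 1`); hence the game's usage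
# `Σ_j X_j σ_j ĝ_j` under-estimates the true older usage of the young's row, every admissible young load lies below the game's cap, and the game's next slack
# `c_z = 1 − X_z s_z − Σ_j X_j σ_j ĝ_j` again dominates the true one — the induction over the ages closes with loads and slacks only, no levels

Cell `pub-balaban`, β-function sub-cell, BINDER row D4 «RemainderConst leaves for Bałaban's split» (`HOME/BINDER-OWNERS.md`; owner lineage `b2b-balaban-beta-an4`;
this file by co-owner #2 lineage `b2b-balaban-beta-d4-p2`, generation 68), β-FLOW TEAM duty (1), FREEZE (0) honoured (def-free, Mathlib only; (E76b) `level_ratio_ge`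
∕ `load_budget_levels_pin` and (E77a) `ratio_mul_slack_ge` ∕ `load_lt_cap` are referred to BY NAME, nothing restated).

HONEST FRAMING (page 1, verbatim and binding).  *"Discharging BetaPertH makes Bałaban's UV stability UNCONDITIONAL — a real constructive-QFT result; it is
NOT the continuum limit and NOT the Clay problem."*  THIS FILE DISCHARGES NOTHING OF THE KIND.  Elementary algebra of finite sums of real numbers — hypotheses of a
census, not facts; the form, signs, ages and moments of Bałaban's (1.22) limit functional are NOT PRINTED ([I] p. 298; GAPS G-t4-U2-1∕-2) and NOT asserted.  Row D4
class UNCHANGED (critical-path width 0; instance 0∕1; D4 DISCHARGE NO DATE).  HONEST DEPENDENCY: continuum YM on T⁴ ⇐ BetaPertH ∧ nine spine estimates (0/9 proved);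
BetaPertH ⇐ (D1) ∧ (D4) ∧ CAP+tail; G-an2-4 gates asym, D1 and NE2/3/4.

THE POINT (README `HOME/b2b-balaban-beta-d4-p2/g68/e77/README.md` §2).  Letters (young scale `z`, its older ages indexed `j = 0, 1, …, n−1` NEAREST FIRST): `X_j = 2x_j`
the loads, `g_j = a_j∕a_z ≥ 1` the true level ratios, `ε_j` the slack of row `j` with respect to the ages older than `j`, `c_j ≥ ε_j` the game's relaxed slack
(`c_j > 0`), `φ_j = S(z,k_j)∕z` the young's reads on row `j`, `S_{ij} = S(k_i,k_j)∕k_i` the reads of the nearer age `i` on row `j`, `σ_j = S(k_j,z)∕k_j` the charge of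
age `j` on the young's row, `s_z = S(z,z)∕z`.  The slack form of row `j` ((E77a) `ratio_mul_slack_ge` with the `1∕a_z` and the younger-than-`z` terms dropped, and
`amplification_ge_of_slack`) is the hypothesis `hslack`; the game's recursion is the hypothesis `hĝ` (satisfied with equality by `satgame.py`).  §1 proves the
majorisation `ĝ ≤ g` by strong induction on the nearness index (the sum over nearer ages is monotone in their ratios), §2 draws the three consequences the
induction over the AGES needs: usage under-estimated, young load below the cap, next relaxed slack above the next true slack.  NOT CLAIMED: that the game closes
(README §3–§5: numerically `sup ρ̂∕lone = 1.000–1.005`, `sup Φ ≈ 0.38`); anything about the flow (the instantiation `a = 1∕h²`, `X_k = L_k k h_k³` is (E76b)'s); anything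
printed.

WHAT IS PROVED ([folklore]; 0 `def`, 0 sorry).  §1 `sum_nearer_mono`, **`majorant_le_ratio`**.  §2 **`usage_ge_game_usage`**, **`young_row_lt_one`**,
**`next_slack_le_relaxed`**, `game_cap_gt_load`.
-/
noncomputable section
open Finset

namespace Summit.QuantumFields.BalabanUV.Beta.EriceRemainderEnclosureHistoryAutonomyComparisonAgeCompositionStaticChainSaturationMajorant

variable {n : ℕ} {g gh X c φ σ : ℕ → ℝ} {S : ℕ → ℕ → ℝ} {Xz : ℝ}

/-! ## §1 Nearest-first majorisation of the level ratios -/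

/-- The nearer ages' reads on a row are monotone in their ratios: `ĝ_i ≤ g_i` for `i < j` and `X_i, S_{ij} ≥ 0` give
`Σ_{i<j} X_i ĝ_i S_{ij} ≤ Σ_{i<j} X_i g_i S_{ij}`. [folklore] -/
theorem sum_nearer_mono {j : ℕ} (hX : ∀ i, i < j → 0 ≤ X i) (hS : ∀ i, i < j → 0 ≤ S i j) (hle : ∀ i, i < j → gh i ≤ g i) :
    ∑ i ∈ range j, X i * gh i * S i j ≤ ∑ i ∈ range j, X i * g i * S i j := by
  refine sum_le_sum fun i hi => ?_
  have hi' := mem_range.mp hi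
  have := mul_le_mul_of_nonneg_left (hle i hi') (hX i hi')
  calc X i * gh i * S i j = (X i * gh i) * S i j := by ring
    _ ≤ (X i * g i) * S i j := mul_le_mul_of_nonneg_right this (hS i hi')
    _ = X i * g i * S i j := by ring

/-- **THE GAME'S RATIOS ARE LOWER BOUNDS.**  Older ages of the young scale indexed nearest first (`j < n`), true ratios `g_j ≥ 1`, loads `X ≥ 0`, reads
`S_{ij} ≥ 0` (no sign needed on `X_z φ_j`), relaxed slacks `c_j > 0` with the rows in slack form `X_z φ_j + Σ_{i<j} X_i g_i S_{ij} ≤ g_j c_j`; then ANY family `ĝ`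
with `ĝ_j ≤ max(1, (X_z φ_j + Σ_{i<j} X_i ĝ_i S_{ij})∕c_j)` for all `j < n` satisfies **`ĝ_j ≤ g_j` for all `j < n`** (strong induction on `j`: the recursion only
reads nearer ages, whose ratios are already dominated). [folklore] -/
theorem majorant_le_ratio (hg1 : ∀ j, j < n → 1 ≤ g j) (hX : ∀ i, i < n → 0 ≤ X i) (hS : ∀ i j, 0 ≤ S i j)
    (hc : ∀ j, j < n → 0 < c j)
    (hslack : ∀ j, j < n → Xz * φ j + ∑ i ∈ range j, X i * g i * S i j ≤ g j * c j)
    (hgh : ∀ j, j < n → gh j ≤ max 1 ((Xz * φ j + ∑ i ∈ range j, X i * gh i * S i j) / c j)) :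
    ∀ j, j < n → gh j ≤ g j := by
  intro j
  induction j using Nat.strong_induction_on with
  | _ j ih =>
    intro hj
    refine (hgh j hj).trans (max_le (hg1 j hj) ?_)
    rw [div_le_iff₀ (hc j hj)]
    have hmono : ∑ i ∈ range j, X i * gh i * S i j ≤ ∑ i ∈ range j, X i * g i * S i j :=
      sum_nearer_mono (fun i hi => hX i (hi.trans hj)) (fun i _ => hS i j) (fun i hi => ih i hi (hi.trans hj))
    linarith [hslack j hj]

/-! ## §2 Consequences for the young's row: usage, cap, next slack -/

/-- **THE GAME UNDER-ESTIMATES THE OLDER USAGE.**  In the setting of `majorant_le_ratio`, with charges `σ_j ≥ 0` of the older ages on the young's row: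
`Σ_{j<n} X_j σ_j ĝ_j ≤ Σ_{j<n} X_j σ_j g_j` — the game's usage `2𝒰(x_z)` is at most the true older usage of row `z`. [folklore] -/
theorem usage_ge_game_usage (hg1 : ∀ j, j < n → 1 ≤ g j) (hX : ∀ i, i < n → 0 ≤ X i) (hS : ∀ i j, 0 ≤ S i j)
    (hσ : ∀ j, j < n → 0 ≤ σ j) (hc : ∀ j, j < n → 0 < c j)
    (hslack : ∀ j, j < n → Xz * φ j + ∑ i ∈ range j, X i * g i * S i j ≤ g j * c j)
    (hgh : ∀ j, j < n → gh j ≤ max 1 ((Xz * φ j + ∑ i ∈ range j, X i * gh i * S i j) / c j)) :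
    ∑ j ∈ range n, X j * σ j * gh j ≤ ∑ j ∈ range n, X j * σ j * g j := by
  have hle := majorant_le_ratio hg1 hX hS hc hslack hgh
  refine sum_le_sum fun j hj => ?_
  have hj' := mem_range.mp hj
  exact mul_le_mul_of_nonneg_left (hle j hj') (mul_nonneg (hX j hj') (hσ j hj'))

/-- **THE YOUNG'S ROW IN GAME FORM.**  If the true row of the young holds, `X_z s_z + Σ_j X_j σ_j g_j ≤ 1 − 1∕a_z` with `a_z > 0` (the level-coupled row divided by
`a_z`, younger ages dropped), then the game's row holds STRICTLY: `X_z s_z + Σ_j X_j σ_j ĝ_j < 1`. [folklore] -/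
theorem young_row_lt_one {sz az : ℝ} (hg1 : ∀ j, j < n → 1 ≤ g j) (hX : ∀ i, i < n → 0 ≤ X i) (hS : ∀ i j, 0 ≤ S i j)
    (hσ : ∀ j, j < n → 0 ≤ σ j) (hc : ∀ j, j < n → 0 < c j)
    (hslack : ∀ j, j < n → Xz * φ j + ∑ i ∈ range j, X i * g i * S i j ≤ g j * c j)
    (hgh : ∀ j, j < n → gh j ≤ max 1 ((Xz * φ j + ∑ i ∈ range j, X i * gh i * S i j) / c j))
    (haz : 0 < az) (hrow : Xz * sz + ∑ j ∈ range n, X j * σ j * g j ≤ 1 - 1 / az) :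
    Xz * sz + ∑ j ∈ range n, X j * σ j * gh j < 1 := by
  have h := usage_ge_game_usage hg1 hX hS hσ hc hslack hgh
  have hpos : 0 < 1 / az := by positivity
  linarith

/-- **THE NEXT RELAXED SLACK DOMINATES THE NEXT TRUE SLACK.**  The young's true slack with respect to its older ages, `ε_z = 1 − X_z s_z − Σ_j X_j σ_j g_j`, is at
most the game's `c_z = 1 − X_z s_z − Σ_j X_j σ_j ĝ_j` — so the hypothesis `c ≥ ε` propagates to the next age and the induction over the ages runs on loads and
relaxed slacks alone. [folklore] -/
theorem next_slack_le_relaxed {sz : ℝ} (hg1 : ∀ j, j < n → 1 ≤ g j) (hX : ∀ i, i < n → 0 ≤ X i) (hS : ∀ i j, 0 ≤ S i j)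
    (hσ : ∀ j, j < n → 0 ≤ σ j) (hc : ∀ j, j < n → 0 < c j)
    (hslack : ∀ j, j < n → Xz * φ j + ∑ i ∈ range j, X i * g i * S i j ≤ g j * c j)
    (hgh : ∀ j, j < n → gh j ≤ max 1 ((Xz * φ j + ∑ i ∈ range j, X i * gh i * S i j) / c j)) :
    1 - Xz * sz - ∑ j ∈ range n, X j * σ j * g j ≤ 1 - Xz * sz - ∑ j ∈ range n, X j * σ j * gh j := by
  have h := usage_ge_game_usage hg1 hX hS hσ hc hslack hgh
  linarith

/-- THE CAP.  If the game's usage is non-decreasing in the young load (it is: every `ĝ_j` is a maximum of non-decreasing affine functions of `X_z`), written here as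
a function `𝒱` of the young load with `𝒱(X_z) = Σ_j X_j σ_j ĝ_j`, and the game's row is exhausted at `X̂`, `X̂ s_z + 𝒱(X̂) ≥ 1`, then the game's strict row
`X_z s_z + 𝒱(X_z) < 1` (`young_row_lt_one`) forces `X_z < X̂` (`s_z > 0`) — (E77a) `load_lt_cap` in this file's letters. [folklore] -/
theorem game_cap_gt_load {𝒱 : ℝ → ℝ} {sz Xh : ℝ} (hsz : 0 < sz) (hmono : Monotone 𝒱) (hrow : Xz * sz + 𝒱 Xz < 1) (hcap : 1 ≤ Xh * sz + 𝒱 Xh) :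
    Xz < Xh := by
  by_contra hx
  have h1 : 𝒱 Xh ≤ 𝒱 Xz := hmono (not_lt.mp hx)
  nlinarith [not_lt.mp hx]

end Summit.QuantumFields.BalabanUV.Beta.EriceRemainderEnclosureHistoryAutonomyComparisonAgeCompositionStaticChainSaturationMajorant

end
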